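import Literature.NumberTheory.GelbartRogawski1991.DoubledUnitaryGlobalSplittingDataGen
import Literature.NumberTheory.GelbartRogawski1991.DoubledUnitarySiegelParabolicAlgebra
import HarnessLib

/-!
# (GENERAL-`(F, E, c)` TWIN of `DoubledUnitarySiegelParabolicAlgebra` — same statements and proofs over the general doubling data of
# `DoubledUnitaryGlobalSplittingDataGen`: any quadratic extension `E/F`, symmetric invertible `TV`, `TW` over `F`; namespace
# `GRConstructionGen`; in the prose read `L⁺ := F`, `L := E`.)

# Block algebra of the Siegel parabolic `P_Δ(𝔸)` of the doubled unitary group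

[GelbartRogawski1991, §3.1 Prop. 3.1.1] by doubling [Kudla1994, §2], [HarrisKudlaSweet1996, §1]: elementary matrix
algebra for the stabiliser `P_Δ` of the diagonal `Δ ⊂ 𝕍 ⊕ 𝕍` in the adelic group `H(𝔸) = U(𝕍 ⊕ −𝕍)(𝔸)` of
`DoubledUnitaryGlobalSplittingData`.  In the basis adapted to `Δ ⊕ (0 ⊕ 𝕍)` — conjugation by the unipotent
`E₂ = (1 0; 1 1)`, `E₁ = E₂⁻¹ = (1 0; −1 1)` — a Siegel element is block upper-triangular with upper-left block
`h|_Δ = h₁₁ + h₁₂`, whence: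
* `det h = det_Δ h · det(h₂₂ − h₁₂)`, so `det_Δ` is a unit on `P_Δ(𝔸)` (`isUnit_detDelta_of_isSiegelDelta`);
* `P_Δ(𝔸)` is closed under products and inverses and contains `1` (`isSiegelDelta_mul ∕ _inv ∕ _one'`);
* `det_Δ` is multiplicative on `P_Δ(𝔸)` (`detDelta_mul`), and so are the prescribed scalars `χ(det_Δ ·)`
  (`chiDet_mul`) and `|det_Δ ·|^{1/2}` (`modDelta_mul`); `det_Δ 1 = 1`, `χ(det_Δ 1) = 1`, `|det_Δ 1|^{1/2} = 1`;
* the Weil operators compose (`opD_mul`), the Siegel relation entrywise (`isSiegelDelta_iff_entry`).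
Theorems only (no definitions).
-/

set_option autoImplicit false

noncomputable section

open scoped Classical
open scoped Matrix Kronecker TensorProduct
open NumberField IsDedekindDomain
open Literature.RepresentationTheory.HeisenbergGroup
open Literature.NumberTheory.Automorphic
open Literature.NumberTheory.Weil1964
open Literature.NumberTheory.GaloisRepresentations

namespace Literature.NumberTheory.GelbartRogawski1991.GRConstructionGen

open UnitaryDualPair

variable (F : Type) [Field F] [NumberField F] (E : Type) [Field E] [NumberField E] [Algebra F E]
  [Algebra.IsQuadraticExtension F E]
variable (c : E ≃ₐ[F] E) {δ : E} (hcδ : c δ = -δ) (hδ : δ ≠ 0) {d : F} (hd : δ * δ = algebraMap F E d)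
variable {N M n : ℕ} (e : Fin N × Fin M ≃ Fin n)
  (TV : Matrix (Fin N) (Fin N) F) (hV : TV.IsSymm) (hVd : IsUnit TV.det)
  (TW : Matrix (Fin M) (Fin M) F) (hW : TW.IsSymm) (hWd : IsUnit TW.det)

/-! ## `det_Δ` is a unit on `P_Δ(𝔸)` -/

omit [NumberField F] [Algebra.IsQuadraticExtension F E] in
/-- block factorisation behind S3-unit: in the basis adapted to `Δ ⊕ (0 ⊕ 𝕍)` a Siegel `h` is block upper-triangular,
`E₁ · h · E₂ = (h|_Δ, h₁₂; 0, h₂₂ − h₁₂)` with unipotent `E₁ = (1 0; −1 1)`, `E₂ = (1 0; 1 1)`.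
[cite: Kudla1994, §2 (doubled space, Siegel parabolic), Thm. 3.1] -/
theorem blk_conj_eq_of_isSiegelDelta (h : HA F E c e TV TW) (hS : IsSiegelDelta F E c e TV TW h) :
    Matrix.fromBlocks (1 : Matrix (Fin n) (Fin n) (AdeleRing (𝓞 E) E)) 0 (-1) 1 * blk F E c e TV TW h *
        Matrix.fromBlocks 1 0 1 1 =
      Matrix.fromBlocks (deltaBlock F E c e TV TW h) (blk F E c e TV TW h).toBlocks₁₂ 0
        ((blk F E c e TV TW h).toBlocks₂₂ - (blk F E c e TV TW h).toBlocks₁₂) := by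
  set B := blk F E c e TV TW h with hB
  have hS' : B.toBlocks₁₁ + B.toBlocks₁₂ = B.toBlocks₂₁ + B.toBlocks₂₂ := hS
  have hB' : B = Matrix.fromBlocks B.toBlocks₁₁ B.toBlocks₁₂ B.toBlocks₂₁ B.toBlocks₂₂ :=
    (Matrix.fromBlocks_toBlocks B).symm
  conv_lhs => rw [hB']
  rw [Matrix.fromBlocks_multiply, Matrix.fromBlocks_multiply]
  simp only [Matrix.one_mul, Matrix.mul_one, Matrix.zero_mul, Matrix.mul_zero, add_zero, zero_add, Matrix.neg_mul,
    neg_add_eq_sub]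
  rw [Matrix.fromBlocks_inj]
  refine ⟨rfl, rfl, ?_, rfl⟩
  have h2 : B.toBlocks₂₁ - B.toBlocks₁₁ + (B.toBlocks₂₂ - B.toBlocks₁₂) =
      (B.toBlocks₂₁ + B.toBlocks₂₂) - (B.toBlocks₁₁ + B.toBlocks₁₂) := by abel
  rw [h2, ← hS', sub_self]

omit [NumberField F] [Algebra.IsQuadraticExtension F E] in
/-- for a Siegel `h`: `det h = det_Δ h · det (h₂₂ − h₁₂)` (block upper-triangular determinant).
[cite: Kudla1994, §2 (doubled space, Siegel parabolic), Thm. 3.1] -/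
theorem det_blk_eq_of_isSiegelDelta (h : HA F E c e TV TW) (hS : IsSiegelDelta F E c e TV TW h) :
    (blk F E c e TV TW h).det =
      detDelta F E c e TV TW h * ((blk F E c e TV TW h).toBlocks₂₂ - (blk F E c e TV TW h).toBlocks₁₂).det := by
  show _ = (deltaBlock F E c e TV TW h).det * _
  have h1 := congrArg Matrix.det (blk_conj_eq_of_isSiegelDelta F E c e TV TW h hS)
  rw [Matrix.det_mul, Matrix.det_mul, Matrix.det_fromBlocks_zero₁₂, Matrix.det_fromBlocks_zero₁₂,
    Matrix.det_fromBlocks_zero₂₁] at h1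
  simpa only [Matrix.det_one, Matrix.det_neg, one_mul, mul_one] using h1

omit [NumberField F] [Algebra.IsQuadraticExtension F E] in
/-- **S3-unit**: for `p ∈ P_Δ(𝔸)`, `det_Δ p` is a unit of `𝔸_L` (`det p = det_Δ p · det(p₂₂ − p₁₂)` and `det p` is a
unit). [cite: Kudla1994, §2 (doubled space, Siegel parabolic), Thm. 3.1] -/
theorem isUnit_detDelta_of_isSiegelDelta (p : HA F E c e TV TW) (hS : IsSiegelDelta F E c e TV TW p) :
    IsUnit (detDelta F E c e TV TW p) := by
  have h1 : IsUnit (blk F E c e TV TW p).det := by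
    dsimp only [blk]
    rw [Matrix.det_reindex_self]
    exact (Matrix.isUnit_iff_isUnit_det _).mp (p : GL (Fin (n + n)) (AdeleRing (𝓞 E) E)).isUnit
  rw [det_blk_eq_of_isSiegelDelta F E c e TV TW p hS] at h1
  exact isUnit_of_mul_isUnit_left h1


/-! ## Conjugation into the basis adapted to `Δ`; products -/

omit [NumberField F] [Algebra.IsQuadraticExtension F E] in
/-- `blk` is multiplicative. [cite: Kudla1994, §2 (doubled space, Siegel parabolic), Thm. 3.1] -/
theorem blk_mul (p q : HA F E c e TV TW) : blk F E c e TV TW (p * q) = blk F E c e TV TW p * blk F E c e TV TW q := by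
  simp only [blk, Matrix.reindex_apply, Equiv.symm_symm, Subgroup.coe_mul, Units.val_mul]
  exact (Matrix.submatrix_mul_equiv _ _ _ _ _).symm

omit [NumberField F] [Algebra.IsQuadraticExtension F E] in
/-- the Siegel condition as vanishing of the lower-left block of `E₁ (blk h) E₂`.
[cite: Kudla1994, §2 (doubled space, Siegel parabolic), Thm. 3.1] -/
theorem isSiegelDelta_iff_conj (h : HA F E c e TV TW) :
    IsSiegelDelta F E c e TV TW h ↔
      (Matrix.fromBlocks (1 : Matrix (Fin n) (Fin n) (AdeleRing (𝓞 E) E)) 0 (-1) 1 * blk F E c e TV TW h *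
        Matrix.fromBlocks 1 0 1 1).toBlocks₂₁ = 0 := by
  rw [GRConstruction.conjE_eq, Matrix.toBlocks_fromBlocks₂₁, sub_eq_zero, eq_comm]
  exact Iff.rfl

omit [NumberField F] [Algebra.IsQuadraticExtension F E] in
/-- `h|_Δ` as the upper-left block of `E₁ (blk h) E₂`.
[cite: Kudla1994, §2 (doubled space, Siegel parabolic), Thm. 3.1] -/
theorem deltaBlock_eq_conj (h : HA F E c e TV TW) :
    deltaBlock F E c e TV TW h =
      (Matrix.fromBlocks (1 : Matrix (Fin n) (Fin n) (AdeleRing (𝓞 E) E)) 0 (-1) 1 * blk F E c e TV TW h *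
        Matrix.fromBlocks 1 0 1 1).toBlocks₁₁ := by
  rw [GRConstruction.conjE_eq, Matrix.toBlocks_fromBlocks₁₁]
  rfl

omit [NumberField F] [Algebra.IsQuadraticExtension F E] in
/-- `E₁ blk(pq) E₂ = (E₁ blk p E₂)(E₁ blk q E₂)`. [cite: Kudla1994, §2 (doubled space, Siegel parabolic), Thm. 3.1] -/
theorem conj_blk_mul (p q : HA F E c e TV TW) :
    Matrix.fromBlocks (1 : Matrix (Fin n) (Fin n) (AdeleRing (𝓞 E) E)) 0 (-1) 1 * blk F E c e TV TW (p * q) *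
        Matrix.fromBlocks 1 0 1 1 =
      Matrix.fromBlocks (1 : Matrix (Fin n) (Fin n) (AdeleRing (𝓞 E) E)) 0 (-1) 1 * blk F E c e TV TW p *
          Matrix.fromBlocks 1 0 1 1 *
        (Matrix.fromBlocks (1 : Matrix (Fin n) (Fin n) (AdeleRing (𝓞 E) E)) 0 (-1) 1 * blk F E c e TV TW q *
          Matrix.fromBlocks 1 0 1 1) := by
  have h : Matrix.fromBlocks (1 : Matrix (Fin n) (Fin n) (AdeleRing (𝓞 E) E)) 0 (-1) 1 * blk F E c e TV TW p *
          Matrix.fromBlocks 1 0 1 1 *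
        (Matrix.fromBlocks (1 : Matrix (Fin n) (Fin n) (AdeleRing (𝓞 E) E)) 0 (-1) 1 * blk F E c e TV TW q *
          Matrix.fromBlocks 1 0 1 1) =
      Matrix.fromBlocks (1 : Matrix (Fin n) (Fin n) (AdeleRing (𝓞 E) E)) 0 (-1) 1 *
        (blk F E c e TV TW p * (Matrix.fromBlocks (1 : Matrix (Fin n) (Fin n) (AdeleRing (𝓞 E) E)) 0 1 1 *
          Matrix.fromBlocks 1 0 (-1) 1) * blk F E c e TV TW q) * Matrix.fromBlocks 1 0 1 1 := by
    simp only [Matrix.mul_assoc]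
  rw [h, GRConstruction.E₂_mul_E₁, Matrix.mul_one, blk_mul]

omit [NumberField F] [Algebra.IsQuadraticExtension F E] in
/-- `P_Δ(𝔸)` is closed under products. [cite: Kudla1994, §2 (doubled space, Siegel parabolic), Thm. 3.1] -/
theorem isSiegelDelta_mul {p q : HA F E c e TV TW} (hp : IsSiegelDelta F E c e TV TW p)
    (hq : IsSiegelDelta F E c e TV TW q) : IsSiegelDelta F E c e TV TW (p * q) :=
  (isSiegelDelta_iff_conj F E c e TV TW (p * q)).2 (by
    rw [conj_blk_mul]
    exact (GRConstruction.toBlocks_mul_of_toBlocks₂₁_eq_zero _ _ ((isSiegelDelta_iff_conj F E c e TV TW p).1 hp)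
      ((isSiegelDelta_iff_conj F E c e TV TW q).1 hq)).1)

omit [NumberField F] [Algebra.IsQuadraticExtension F E] in
/-- `(pq)|_Δ = p|_Δ q|_Δ` on `P_Δ(𝔸)`. [cite: Kudla1994, §2 (doubled space, Siegel parabolic), Thm. 3.1] -/
theorem deltaBlock_mul {p q : HA F E c e TV TW} (hp : IsSiegelDelta F E c e TV TW p)
    (hq : IsSiegelDelta F E c e TV TW q) :
    deltaBlock F E c e TV TW (p * q) = deltaBlock F E c e TV TW p * deltaBlock F E c e TV TW q := by
  rw [deltaBlock_eq_conj, deltaBlock_eq_conj, deltaBlock_eq_conj, conj_blk_mul]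
  exact (GRConstruction.toBlocks_mul_of_toBlocks₂₁_eq_zero _ _ ((isSiegelDelta_iff_conj F E c e TV TW p).1 hp)
    ((isSiegelDelta_iff_conj F E c e TV TW q).1 hq)).2

omit [NumberField F] [Algebra.IsQuadraticExtension F E] in
/-- `det_Δ` is multiplicative on `P_Δ(𝔸)`. [cite: Kudla1994, §2 (doubled space, Siegel parabolic), Thm. 3.1] -/
theorem detDelta_mul {p q : HA F E c e TV TW} (hp : IsSiegelDelta F E c e TV TW p)
    (hq : IsSiegelDelta F E c e TV TW q) :
    detDelta F E c e TV TW (p * q) = detDelta F E c e TV TW p * detDelta F E c e TV TW q := by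
  unfold detDelta
  rw [deltaBlock_mul F E c e TV TW hp hq, Matrix.det_mul]

omit [NumberField F] [Algebra.IsQuadraticExtension F E] in
/-- `χ(det_Δ ·)` is multiplicative on `P_Δ(𝔸)`. [cite: Kudla1994, §2 (doubled space, Siegel parabolic), Thm. 3.1] -/
theorem chiDet_mul (χ : HeckeCharacter E) {p q : HA F E c e TV TW} (hp : IsSiegelDelta F E c e TV TW p)
    (hq : IsSiegelDelta F E c e TV TW q) :
    chiDet F E c e TV TW χ (p * q) = chiDet F E c e TV TW χ p * chiDet F E c e TV TW χ q := by
  have hup := isUnit_detDelta_of_isSiegelDelta F E c e TV TW p hp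
  have huq := isUnit_detDelta_of_isSiegelDelta F E c e TV TW q hq
  have hu := isUnit_detDelta_of_isSiegelDelta F E c e TV TW (p * q) (isSiegelDelta_mul F E c e TV TW hp hq)
  have hunit : hu.unit = hup.unit * huq.unit :=
    Units.ext (by rw [Units.val_mul, IsUnit.unit_spec, IsUnit.unit_spec, IsUnit.unit_spec, detDelta_mul F E c e TV TW hp hq])
  unfold chiDet
  rw [dif_pos hu, dif_pos hup, dif_pos huq, ← map_mul, hunit]

omit [NumberField F] [Algebra.IsQuadraticExtension F E] in
/-- `|det_Δ ·|^{1/2}` is multiplicative on `P_Δ(𝔸)`.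
[cite: Kudla1994, §2 (doubled space, Siegel parabolic), Thm. 3.1] -/
theorem modDelta_mul {p q : HA F E c e TV TW} (hp : IsSiegelDelta F E c e TV TW p)
    (hq : IsSiegelDelta F E c e TV TW q) :
    modDelta F E c e TV TW (p * q) = modDelta F E c e TV TW p * modDelta F E c e TV TW q := by
  have hup := isUnit_detDelta_of_isSiegelDelta F E c e TV TW p hp
  have huq := isUnit_detDelta_of_isSiegelDelta F E c e TV TW q hq
  have hu := isUnit_detDelta_of_isSiegelDelta F E c e TV TW (p * q) (isSiegelDelta_mul F E c e TV TW hp hq)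
  have hunit : hu.unit = hup.unit * huq.unit :=
    Units.ext (by rw [Units.val_mul, IsUnit.unit_spec, IsUnit.unit_spec, IsUnit.unit_spec, detDelta_mul F E c e TV TW hp hq])
  unfold modDelta
  rw [dif_pos hu, dif_pos hup, dif_pos huq, hunit, ← coe_ideleNorm, ← coe_ideleNorm, ← coe_ideleNorm, map_mul, NNReal.coe_mul,
    Real.sqrt_mul (NNReal.coe_nonneg _)]

set_option maxHeartbeats 800000 in
/-- `ω(XY)Φ = ω(X)(ω(Y)Φ)` as functions. [cite: Kudla1994, §2 (doubled space, Siegel parabolic), Thm. 3.1] -/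
theorem opD_mul (X Y : MpD F e TV TW) (Φ : piSchwartzBruhat F (Fin (n + n))) :
    opD F e TV TW (X * Y) Φ =
      opD F e TV TW X (adelicMpCont.omega F (Fin (n + n)) (gramDA F e TV TW) Y Φ) := by
  exact congrArg (fun T : piSchwartzBruhat F (Fin (n + n)) →ₗ[ℂ] piSchwartzBruhat F (Fin (n + n)) =>
      ((T Φ : piSchwartzBruhat F (Fin (n + n))) : (Fin (n + n) → AdeleRing (𝓞 F) F) → ℂ))
    ((adelicMpCont.omega F (Fin (n + n)) (gramDA F e TV TW)).map_mul X Y)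

omit [NumberField F] [Algebra.IsQuadraticExtension F E] in
/-- the Siegel condition entrywise. [cite: Kudla1994, §2 (doubled space, Siegel parabolic), Thm. 3.1] -/
theorem isSiegelDelta_iff_entry (X : HA F E c e TV TW) :
    IsSiegelDelta F E c e TV TW X ↔ ∀ i j : Fin n,
      ((X : GL (Fin (n + n)) (AdeleRing (𝓞 E) E)) : Matrix _ _ (AdeleRing (𝓞 E) E)) (e₂ (Sum.inl i)) (e₂ (Sum.inl j)) +
          ((X : GL (Fin (n + n)) (AdeleRing (𝓞 E) E)) : Matrix _ _ (AdeleRing (𝓞 E) E)) (e₂ (Sum.inl i)) (e₂ (Sum.inr j)) =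
        ((X : GL (Fin (n + n)) (AdeleRing (𝓞 E) E)) : Matrix _ _ (AdeleRing (𝓞 E) E)) (e₂ (Sum.inr i)) (e₂ (Sum.inl j)) +
          ((X : GL (Fin (n + n)) (AdeleRing (𝓞 E) E)) : Matrix _ _ (AdeleRing (𝓞 E) E)) (e₂ (Sum.inr i)) (e₂ (Sum.inr j)) := by
  unfold IsSiegelDelta
  rw [← Matrix.ext_iff]
  simp only [blk, Matrix.add_apply, Matrix.toBlocks₁₁, Matrix.toBlocks₁₂, Matrix.toBlocks₂₁, Matrix.toBlocks₂₂,
    Matrix.of_apply, Matrix.reindex_apply, Matrix.submatrix_apply, Equiv.symm_symm]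

/-! ## Inverses and the identity -/

omit [NumberField F] [Algebra.IsQuadraticExtension F E] in
/-- `E₁ blk(1) E₂ = 1`. [cite: Kudla1994, §2 (doubled space, Siegel parabolic), Thm. 3.1] -/
theorem conj_blk_one :
    Matrix.fromBlocks (1 : Matrix (Fin n) (Fin n) (AdeleRing (𝓞 E) E)) 0 (-1) 1 * blk F E c e TV TW 1 *
        Matrix.fromBlocks 1 0 1 1 = 1 := by
  have h1 : blk F E c e TV TW 1 = 1 := by
    simp only [blk, Matrix.reindex_apply, Subgroup.coe_one, Units.val_one, Matrix.submatrix_one_equiv]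
  rw [h1, Matrix.mul_one, GRConstruction.E₁_mul_E₂]

omit [NumberField F] [Algebra.IsQuadraticExtension F E] in
/-- **`P_Δ(𝔸)` is closed under inverses.** [cite: Kudla1994, §2 (doubled space, Siegel parabolic), Thm. 3.1] -/
theorem isSiegelDelta_inv {p : HA F E c e TV TW} (hp : IsSiegelDelta F E c e TV TW p) :
    IsSiegelDelta F E c e TV TW p⁻¹ := by
  set X := Matrix.fromBlocks (1 : Matrix (Fin n) (Fin n) (AdeleRing (𝓞 E) E)) 0 (-1) 1 * blk F E c e TV TW p *
    Matrix.fromBlocks 1 0 1 1 with hX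
  set Y := Matrix.fromBlocks (1 : Matrix (Fin n) (Fin n) (AdeleRing (𝓞 E) E)) 0 (-1) 1 * blk F E c e TV TW p⁻¹ *
    Matrix.fromBlocks 1 0 1 1 with hY
  have hXY : X * Y = 1 := by rw [hX, hY, ← conj_blk_mul, mul_inv_cancel, conj_blk_one]
  have hX21 : X.toBlocks₂₁ = 0 := (isSiegelDelta_iff_conj F E c e TV TW p).1 hp
  -- `det X` is a unit, hence so is `det X₂₂`
  have hXu : IsUnit X.det := by
    have h : IsUnit (X * Y).det := by rw [hXY, Matrix.det_one]; exact isUnit_one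
    rw [Matrix.det_mul] at h
    exact isUnit_of_mul_isUnit_left h
  have hXblocks : X = Matrix.fromBlocks X.toBlocks₁₁ X.toBlocks₁₂ 0 X.toBlocks₂₂ := by
    conv_lhs => rw [← Matrix.fromBlocks_toBlocks X, hX21]
  have hD : IsUnit X.toBlocks₂₂.det := by
    rw [hXblocks, Matrix.det_fromBlocks_zero₂₁] at hXu
    exact isUnit_of_mul_isUnit_right hXu
  -- `(XY)₂₁ = X₂₂ Y₂₁ = 0`
  have h21 : X.toBlocks₂₂ * Y.toBlocks₂₁ = 0 := by
    have h := congrArg Matrix.toBlocks₂₁ hXY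
    rw [hXblocks, ← Matrix.fromBlocks_toBlocks Y, Matrix.fromBlocks_multiply, Matrix.toBlocks_fromBlocks₂₁,
      Matrix.zero_mul, zero_add] at h
    rw [h, ← Matrix.fromBlocks_one, Matrix.toBlocks_fromBlocks₂₁]
  refine (isSiegelDelta_iff_conj F E c e TV TW p⁻¹).2 ?_
  calc Y.toBlocks₂₁ = X.toBlocks₂₂⁻¹ * (X.toBlocks₂₂ * Y.toBlocks₂₁) := by
        rw [← Matrix.mul_assoc, Matrix.nonsing_inv_mul _ hD, Matrix.one_mul]
    _ = 0 := by rw [h21, Matrix.mul_zero]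


omit [NumberField F] [Algebra.IsQuadraticExtension F E] in
/-- `blk 1 = 1`. [cite: Kudla1994, §2 (doubled space, Siegel parabolic), Thm. 3.1] -/
theorem blk_one : blk F E c e TV TW 1 = 1 := by
  simp only [blk, Matrix.reindex_apply, Subgroup.coe_one, Units.val_one, Matrix.submatrix_one_equiv]

omit [NumberField F] [Algebra.IsQuadraticExtension F E] in
/-- `1 ∈ P_Δ(𝔸)`. [cite: Kudla1994, §2 (doubled space, Siegel parabolic), Thm. 3.1] -/
theorem isSiegelDelta_one' : IsSiegelDelta F E c e TV TW 1 := by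
  unfold IsSiegelDelta
  rw [blk_one, ← Matrix.fromBlocks_one, Matrix.toBlocks_fromBlocks₁₁, Matrix.toBlocks_fromBlocks₁₂,
    Matrix.toBlocks_fromBlocks₂₁, Matrix.toBlocks_fromBlocks₂₂, add_zero, zero_add]

omit [NumberField F] [Algebra.IsQuadraticExtension F E] in
/-- `det_Δ 1 = 1`. [cite: Kudla1994, §2 (doubled space, Siegel parabolic), Thm. 3.1] -/
theorem detDelta_one' : detDelta F E c e TV TW 1 = 1 := by
  unfold detDelta deltaBlock
  rw [blk_one, ← Matrix.fromBlocks_one, Matrix.toBlocks_fromBlocks₁₁, Matrix.toBlocks_fromBlocks₁₂, add_zero,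
    Matrix.det_one]

omit [NumberField F] [Algebra.IsQuadraticExtension F E] in
/-- `det_Δ p⁻¹ · det_Δ p = 1` on `P_Δ(𝔸)`. [cite: Kudla1994, §2 (doubled space, Siegel parabolic), Thm. 3.1] -/
theorem detDelta_inv_mul {p : HA F E c e TV TW} (hp : IsSiegelDelta F E c e TV TW p) :
    detDelta F E c e TV TW p⁻¹ * detDelta F E c e TV TW p = 1 := by
  rw [← detDelta_mul F E c e TV TW (isSiegelDelta_inv F E c e TV TW hp) hp, inv_mul_cancel, detDelta_one']

omit [NumberField F] [Algebra.IsQuadraticExtension F E] in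
/-- `det_Δ p · det_Δ p⁻¹ = 1` on `P_Δ(𝔸)`. [cite: Kudla1994, §2 (doubled space, Siegel parabolic), Thm. 3.1] -/
theorem detDelta_mul_inv {p : HA F E c e TV TW} (hp : IsSiegelDelta F E c e TV TW p) :
    detDelta F E c e TV TW p * detDelta F E c e TV TW p⁻¹ = 1 := by
  rw [← detDelta_mul F E c e TV TW hp (isSiegelDelta_inv F E c e TV TW hp), mul_inv_cancel, detDelta_one']

/-! ## The prescribed scalars at `1` -/

omit [NumberField F] [Algebra.IsQuadraticExtension F E] in
/-- `χ(det_Δ 1) = 1`. [cite: Kudla1994, §2 (doubled space, Siegel parabolic), Thm. 3.1] -/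
theorem chiDet_one' (χ : HeckeCharacter E) : chiDet F E c e TV TW χ 1 = 1 := by
  have hu : IsUnit (detDelta F E c e TV TW 1) := by rw [detDelta_one']; exact isUnit_one
  have h1 : hu.unit = 1 := Units.ext (by rw [IsUnit.unit_spec, detDelta_one', Units.val_one])
  unfold chiDet
  rw [dif_pos hu, h1, map_one]

omit [NumberField F] [Algebra.IsQuadraticExtension F E] in
/-- `|det_Δ 1|^{1/2} = 1`. [cite: Kudla1994, §2 (doubled space, Siegel parabolic), Thm. 3.1] -/
theorem modDelta_one' : modDelta F E c e TV TW 1 = 1 := by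
  have hu : IsUnit (detDelta F E c e TV TW 1) := by rw [detDelta_one']; exact isUnit_one
  have h1 : hu.unit = 1 := Units.ext (by rw [IsUnit.unit_spec, detDelta_one', Units.val_one])
  unfold modDelta
  rw [dif_pos hu, h1, ← coe_ideleNorm, map_one, NNReal.coe_one, Real.sqrt_one]


end Literature.NumberTheory.GelbartRogawski1991.GRConstructionGen
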